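import Literature.NumberTheory.Automorphic.HidaTowerDiamondCentre
import HarnessLib

/-!
# The Hecke algebras of the Hida tower of `GL₂` are commutative; the ordinary part is `⋂ₘ U_p^m H`

Topic `NumberTheory/Automorphic`; namespaces `Literature.NumberTheory.Automorphic.ArithmeticQuotient`
(generic part) and `Literature.NumberTheory.Automorphic.BigHeckeGLn.TameLevel`; theorems only.
Proof file supporting the named fact
`Literature.NumberTheory.Automorphic.hidaControl_dominantOrdinaryPoint` (Hida's control theorem in
consequence form, `BianchiOrdinaryClassicality`), whose printed proofs ([Hida1994AIF, §§2–3],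
[KhareThorne2017, §6.2 Lemma 6.5 and §6.3]) use throughout that the Hecke algebra generated by the
`T_{w,j}` (`w ∉ S`), the `U_{v,j}` and the diamond operators `⟨u⟩_v` (`v ∣ p`) at Iwahori level
is COMMUTATIVE, and that the ordinary part is `e H = ⋂ₘ U_p^m H`.  For the tree's model
(`OrdinaryCompletedCohomologyGL`: `𝕋^{S,ord}(𝒰)`, `TameLevel.ordinaryPart` = the Hecke-stable hull
`⋂_{v,j,m} 𝕋 · U_{v,j}^m H`) we prove, for `GL₂` over any number field and `U` maximal above `p`:

* `ArithmeticQuotient.heckeFun_comm_of_normalizer` (generic): if `h` normalises the level `L` and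
  commutes with `g`, then `[L g L]` and `[L h L]` commute (conjugation by `h` permutes `L g L / L`).
* `TameLevel.isUnramifiedLevel_hidaLevel`, `isUnramifiedLevel_hidaLevel_of_mem`: the Hida level
  `U(r)` is factorizable at every good place (`U(r) = U(r)ʷ × GL_n(𝒪_w)`) and at every `v ∣ p`
  (`U(r) = U(r)ᵛ × Iw_v(r, max r 1)`), in the sense of `ArithmeticQuotient.IsUnramifiedLevel`; hence
  (`ArithmeticQuotientHeckeLocal`) Hecke operators of the Hida tower at DIFFERENT places commute
  (`heckeFun_hidaLevel_comm_of_ne`, any `n`), and at the same good place they commute by Gelfand's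
  trick (`heckeFun_hidaLevel_comm_of_not_mem`, any `n`).
* `TameLevel.heckeFun_hidaLevel_comm`, `hidaFamily_comm` (**`n = 2`**): ANY two Hecke operators of
  Hida elements (`T_{w,j}, T_{w,2}⁻¹, U_{v,j}, ⟨u⟩_v`) commute on every `H^i(X_{U(r)}, k/p^s)` — at a
  place `v ∣ p` a Hida element of `GL₂` is `t_{v,1}` or normalises every `U(r)` (it is `1`, central,
  or a diamond), and all of them are diagonal at `v`, so the generic lemma applies.
* Consequences (`n = 2`): the finite-level algebras `hidaLevelSubring` are commutative
  (`hidaLevelSubring_mul_comm`); **`𝕋^S(𝒰; p)` and the ordinary big Hecke algebra `𝕋^{S,ord}(𝒰)`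
  are commutative** (`hidaHeckeSubring_mul_comm`, `ordHeckeSubring_mul_comm`,
  `OrdinaryHeckeAlgebraGLn.mul_comm_of_isMaximalAbove`); and **the ordinary part is
  `H^{ord} = ⋂_{v ∣ p} ⋂ₘ U_{v,1}^m H`** (`ordinaryPart_eq_iInf_range`: the hypothesis of the tree's
  `ordSpan_eq_range` / `iInf_ordSpan_eq_range` is discharged), i.e. Hida's `e H` as soon as `H` is
  finite [KhareThorne2017, §2.4, Lemma 2.10].

## References

* H. Hida, *p-adic ordinary Hecke algebras for GL(2)*, Ann. Inst. Fourier 44 (1994), §2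
  (held; read 2026-08-16). [Hida1994AIF]
* C. Khare, J. A. Thorne, *Potential automorphy and the Leopoldt conjecture*, Amer. J. Math. 139
  (2017), §6.2, Lemma 6.5; §6.3 (arXiv:1409.7007, held; read 2026-08-16). [KhareThorne2017]
* D. Bump, *Automorphic forms and representations* (1997), Thm. 4.6.1 (Gelfand's trick). [Bump1997]
-/

noncomputable section

open scoped NumberField
open IsDedekindDomain CategoryTheory MulAction

namespace Literature.NumberTheory.Automorphic

/-! ### Generic: an element of the normaliser commuting with `g` gives commuting Hecke operators -/

namespace ArithmeticQuotient

variable (k : Type) [CommRing k] {Γ 𝒢 : Type} [Group Γ] [Group 𝒢] (ι : Γ →* 𝒢)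
  {L : Subgroup 𝒢} (M : Type) [AddCommGroup M] [Module k M]

omit [Group Γ] in
/-- **Hecke operators of commuting elements, one of which normalises the level, commute.**  If
`h⁻¹ L h = L` and `g h = h g` then `[L g L] ∘ [L h L] = [L h L] ∘ [L g L]` on `Fun(𝒢 ⧸ L, M)`:
`[L h L]` is right translation by `h` (`heckeFun_apply_mk_of_conj`), and conjugation by `h`
permutes `L g L / L`, so `∑_{aL ⊆ LgL} f(x a h L) = ∑_{aL ⊆ LgL} f(x h a L)`.  (Used for the diamond
operators and the central `U_{v,n}^{±1}` against `U_{v,j}`.) [folklore] -/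
theorem heckeFun_comm_of_normalizer {g h : 𝒢} (hh : ∀ l ∈ L, h⁻¹ * l * h ∈ L)
    (hh' : ∀ l ∈ L, h * l * h⁻¹ ∈ L) (hgh : g * h = h * g) :
    heckeFun k L g M ∘ₗ heckeFun k L h M = heckeFun k L h M ∘ₗ heckeFun k L g M := by
  classical
  by_cases hfin : (doubleCosetQuot L g).Finite
  swap
  · rw [heckeFun_eq_zero_of_infinite k M L g hfin, LinearMap.zero_comp, LinearMap.comp_zero]
  -- conjugation by `h` on `𝒢 ⧸ L`
  have hrel : ∀ a b : 𝒢, QuotientGroup.leftRel L a b ↔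
      QuotientGroup.leftRel L (((Equiv.mulLeft h⁻¹).trans (Equiv.mulRight h)) a)
        (((Equiv.mulLeft h⁻¹).trans (Equiv.mulRight h)) b) := by
    intro a b
    rw [QuotientGroup.leftRel_apply, QuotientGroup.leftRel_apply]
    change a⁻¹ * b ∈ L ↔ (h⁻¹ * a * h)⁻¹ * (h⁻¹ * b * h) ∈ L
    rw [show (h⁻¹ * a * h)⁻¹ * (h⁻¹ * b * h) = h⁻¹ * (a⁻¹ * b) * h by group]
    refine ⟨hh _, fun hab => ?_⟩
    have := hh' _ hab
    rwa [show h * (h⁻¹ * (a⁻¹ * b) * h) * h⁻¹ = a⁻¹ * b by group] at this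
  let φ : 𝒢 ⧸ L ≃ 𝒢 ⧸ L := Quotient.congr ((Equiv.mulLeft h⁻¹).trans (Equiv.mulRight h)) hrel
  have hφ : ∀ a : 𝒢, φ (a : 𝒢 ⧸ L) = ((h⁻¹ * a * h : 𝒢) : 𝒢 ⧸ L) := fun a => rfl
  have hgh' : g⁻¹ * h⁻¹ = h⁻¹ * g⁻¹ := by rw [← mul_inv_rev, ← mul_inv_rev, hgh]
  refine LinearMap.ext fun f => funext fun c => ?_
  induction c using QuotientGroup.induction_on with
  | H x =>
    rw [LinearMap.comp_apply, LinearMap.comp_apply, heckeFun_apply_coe k L M g _ x hfin,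
      heckeFun_apply_mk_of_conj k M hh, heckeFun_apply_coe k L M g f (x * h) hfin]
    refine Finset.sum_equiv φ (fun d => ?_) (fun d _ => ?_)
    · simp only [Set.Finite.mem_toFinset]
      obtain ⟨a, rfl⟩ := QuotientGroup.mk_surjective d
      rw [hφ]
      constructor
      · rintro ⟨l, hl⟩
        refine ⟨⟨h⁻¹ * l * h, hh _ l.2⟩, ?_⟩
        change ((l : 𝒢) • (g : 𝒢 ⧸ L)) = (a : 𝒢 ⧸ L) at hl
        change ((h⁻¹ * l * h : 𝒢) • (g : 𝒢 ⧸ L)) = _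
        rw [MulAction.Quotient.smul_coe, smul_eq_mul, QuotientGroup.eq] at hl ⊢
        have h1 := hh _ hl
        rwa [show h⁻¹ * (((l : 𝒢) * g)⁻¹ * a) * h = h⁻¹ * g⁻¹ * ((l : 𝒢)⁻¹ * a * h) by group,
          ← hgh', show g⁻¹ * h⁻¹ * ((l : 𝒢)⁻¹ * a * h) = (h⁻¹ * l * h * g)⁻¹ * (h⁻¹ * a * h) by
            group] at h1
      · rintro ⟨l, hl⟩
        refine ⟨⟨h * l * h⁻¹, hh' _ l.2⟩, ?_⟩
        change ((l : 𝒢) • (g : 𝒢 ⧸ L)) = ((h⁻¹ * a * h : 𝒢) : 𝒢 ⧸ L) at hl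
        change ((h * l * h⁻¹ : 𝒢) • (g : 𝒢 ⧸ L)) = _
        rw [MulAction.Quotient.smul_coe, smul_eq_mul, QuotientGroup.eq] at hl ⊢
        have h1 := hh' _ hl
        have hgh'' : h * g⁻¹ = g⁻¹ * h :=
          calc h * g⁻¹ = g⁻¹ * (g * h) * g⁻¹ := by group
            _ = g⁻¹ * (h * g) * g⁻¹ := by rw [hgh]
            _ = g⁻¹ * h := by group
        have e1 : h * (((l : 𝒢) * g)⁻¹ * (h⁻¹ * a * h)) * h⁻¹ = h * g⁻¹ * ((l : 𝒢)⁻¹ * h⁻¹ * a) := by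
          group
        have e2 : (h * (l : 𝒢) * h⁻¹ * g)⁻¹ * a = g⁻¹ * h * ((l : 𝒢)⁻¹ * h⁻¹ * a) := by group
        rw [e2, ← hgh'']
        rwa [e1] at h1
    · obtain ⟨a, rfl⟩ := QuotientGroup.mk_surjective d
      rw [hφ, MulAction.Quotient.smul_coe, MulAction.Quotient.smul_coe, smul_eq_mul, smul_eq_mul,
        heckeFun_apply_mk_of_conj k M hh, show x * h * (h⁻¹ * a * h) = x * a * h by group]

/-- Commuting Hecke operators on `Fun(𝒢 ⧸ L, M)` give commuting Hecke operators `T_g`, `T_{g'}` on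
`H^i(X_L, M)` (as `k`-linear endomorphisms; `heckeOperator_comm`). [folklore] -/
theorem heckeEnd_comm_of_heckeFun_comm {g g' : 𝒢}
    (hc : heckeFun k L g M ∘ₗ heckeFun k L g' M = heckeFun k L g' M ∘ₗ heckeFun k L g M) (i : ℕ) :
    heckeEnd k L g M ι i * heckeEnd k L g' M ι i = heckeEnd k L g' M ι i * heckeEnd k L g M ι i := by
  have h := heckeOperator_comm k M ι hc i
  rw [Module.End.mul_eq_comp, Module.End.mul_eq_comp, heckeEnd, heckeEnd, ← ModuleCat.hom_comp,
    ← ModuleCat.hom_comp, h]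

/-- **Hecke operators on `H^i(X_L, M)` of commuting elements, one of which normalises the level,
commute.** [folklore] -/
theorem heckeEnd_comm_of_normalizer {g h : 𝒢} (hh : ∀ l ∈ L, h⁻¹ * l * h ∈ L)
    (hh' : ∀ l ∈ L, h * l * h⁻¹ ∈ L) (hgh : g * h = h * g) (i : ℕ) :
    heckeEnd k L g M ι i * heckeEnd k L h M ι i = heckeEnd k L h M ι i * heckeEnd k L g M ι i :=
  heckeEnd_comm_of_heckeFun_comm k ι M (heckeFun_comm_of_normalizer k M hh hh' hgh) i

end ArithmeticQuotient

/-! ### The Hida levels are factorizable at the Hida places -/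

namespace BigHeckeGLn

variable {n : ℕ} {K : Type} [Field K] [NumberField K]

/-- `t_{w,0} = 1` (private: the same statement is proved in a Summits-side file, which Literature
may not import). [folklore] -/
private theorem heckeElement_zero_eq_one (w : HeightOneSpectrum (𝓞 K)) : heckeElement n K w 0 = 1 := by
  have h : (fun k : Fin n => if k.val < 0 then uniformizerIdele K w (uniformizerAt w) else 1) = 1 :=
    funext fun k => if_neg (Nat.not_lt_zero _)
  rw [heckeElement, h, map_one]

/-- `t_{w,j} = t_{w,n}` for `j ≥ n` (all entries are `ϖ_w`; private for the same reason).
[folklore] -/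
private theorem heckeElement_of_le (w : HeightOneSpectrum (𝓞 K)) {j : ℕ} (hj : n ≤ j) :
    heckeElement n K w j = heckeElement n K w n := by
  unfold heckeElement
  congr 1
  funext k
  rw [if_pos (lt_of_lt_of_le k.isLt hj), if_pos k.isLt]

namespace TameLevel

variable {p : ℕ} [Fact p.Prime] (𝒰 : TameLevel n K p)

/-- **`U(r)` is unramified at every good place `w ∉ S`**: `U(r) = U(r)ʷ × GL_n(𝒪_w)`
(`ArithmeticQuotient.IsUnramifiedLevel`; the Hida levels only shrink above `p`).
[cite: KhareThorne2017, §6.2] -/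
theorem isUnramifiedLevel_hidaLevel (r : ℕ) {w : HeightOneSpectrum (𝓞 K)} (hw : w ∉ 𝒰.bad) :
    ArithmeticQuotient.IsUnramifiedLevel (valuedCongruenceSubgroup (Fin n)
      (1 : WithZero (Multiplicative ℤ))) (ofLocal n K w) (localComponent n K w) (𝒰.hidaLevel r) := by
  refine isUnramifiedLevel_of_le ?_ fun u hu =>
    localComponent_mem_valuedCongruenceSubgroup_one (𝒰.le_glFiniteIntegralLevel (𝒰.hidaLevel_le r hu)) w
  rintro _ ⟨g, hg, rfl⟩
  have h := ofLocal_localComponent_mem_hidaLevel hw (𝒰.ofLocal_mem w hw g hg) r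
  rwa [localComponent_ofLocal] at h

/-- **`U(r)` is factorizable at every `v ∣ p` with local factor the Iwahori level
`Iw_v(r, max r 1)`** (`U` maximal above `p`): `U(r) = U(r)ᵛ × Iw_v(r, max r 1)` in the sense of
`ArithmeticQuotient.IsUnramifiedLevel` (whose "`Kᵥ`" may be any local level).
[cite: KhareThorne2017, §6.3 (U(b,c) = U^p × ∏ I_v(b,c))] -/
theorem isUnramifiedLevel_hidaLevel_of_mem (h𝒰 : 𝒰.IsMaximalAbove) (r : ℕ)
    {v : HeightOneSpectrum (𝓞 K)} (hv : (p : 𝓞 K) ∈ v.asIdeal) :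
    ArithmeticQuotient.IsUnramifiedLevel (iwahoriLevel n v r (max r 1)) (ofLocal n K v)
      (localComponent n K v) (𝒰.hidaLevel r) where
  apply_apply := localComponent_ofLocal
  comm_of_apply_eq_one _ hx := mul_ofLocal_comm hx
  map_le := by
    rintro _ ⟨g, hg, rfl⟩
    rw [mem_hidaLevel_iff]
    refine ⟨h𝒰.ofLocal_mem v hv g (valuedIwahoriSubgroup_le_valuedCongruenceSubgroup_one hg),
      fun w hw => ?_⟩
    by_cases hwv : w = v
    · subst hwv
      rwa [localComponent_ofLocal]
    · rw [localComponent_ofLocal_of_ne hwv]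
      exact one_mem _
  le_comap u hu := ((mem_hidaLevel_iff 𝒰 r u).1 hu).2 v hv

/-- At every Hida place `w` (good, or above `p`), `U(r)` is factorizable with SOME local level.
[folklore] -/
theorem exists_isUnramifiedLevel_hidaLevel (h𝒰 : 𝒰.IsMaximalAbove) (r : ℕ)
    {w : HeightOneSpectrum (𝓞 K)} (hw : 𝒰.IsHidaPlace w) :
    ∃ Kw : Subgroup (GL (Fin n) (w.adicCompletion K)),
      ArithmeticQuotient.IsUnramifiedLevel Kw (ofLocal n K w) (localComponent n K w) (𝒰.hidaLevel r) := by
  by_cases hp : (p : 𝓞 K) ∈ w.asIdeal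
  · exact ⟨_, 𝒰.isUnramifiedLevel_hidaLevel_of_mem h𝒰 r hp⟩
  · exact ⟨_, 𝒰.isUnramifiedLevel_hidaLevel r (Or.resolve_right hw hp)⟩

/-! ### Hecke operators of the Hida tower at different places, or at one good place, commute -/

/-- **Different Hida places commute** (any `n`): for Hida places `v ≠ w` and local elements
`x ∈ GL_n(K_v)`, `y ∈ GL_n(K_w)`, the operators `[U(r) ι_v(x) U(r)]` and `[U(r) ι_w(y) U(r)]`
commute on `Fun(GL_n(𝔸^∞)/U(r), M)` (`heckeFun_comm_of_orthogonal`). [cite: KhareThorne2017, §6.2] -/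
theorem heckeFun_hidaLevel_comm_of_ne (h𝒰 : 𝒰.IsMaximalAbove) (k : Type) [CommRing k]
    (M : Type) [AddCommGroup M] [Module k M] (r : ℕ) {v w : HeightOneSpectrum (𝓞 K)}
    (hv : 𝒰.IsHidaPlace v) (hw : 𝒰.IsHidaPlace w) (hvw : v ≠ w)
    (x : GL (Fin n) (v.adicCompletion K)) (y : GL (Fin n) (w.adicCompletion K)) :
    ArithmeticQuotient.heckeFun k (𝒰.hidaLevel r) (ofLocal n K v x) M ∘ₗ
        ArithmeticQuotient.heckeFun k (𝒰.hidaLevel r) (ofLocal n K w y) M =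
      ArithmeticQuotient.heckeFun k (𝒰.hidaLevel r) (ofLocal n K w y) M ∘ₗ
        ArithmeticQuotient.heckeFun k (𝒰.hidaLevel r) (ofLocal n K v x) M := by
  obtain ⟨Kv, hKv⟩ := 𝒰.exists_isUnramifiedLevel_hidaLevel h𝒰 r hv
  obtain ⟨Kw, hKw⟩ := 𝒰.exists_isUnramifiedLevel_hidaLevel h𝒰 r hw
  exact ArithmeticQuotient.heckeFun_comm_of_orthogonal k M hKv hKw
    (fun g => localComponent_ofLocal_of_ne (Ne.symm hvw) g) x y

/-- **One good place commutes** (any `n`): for `w ∉ S` and `x, y ∈ GL_n(K_w)` the operators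
`[U(r) ι_w(x) U(r)]`, `[U(r) ι_w(y) U(r)]` commute (Gelfand's trick with the transpose and the
Cartan decomposition, `heckeFun_comm_of_antiInvolution`). [cite: Bump1997, Thm. 4.6.1] -/
theorem heckeFun_hidaLevel_comm_of_not_mem (k : Type) [CommRing k] (M : Type) [AddCommGroup M]
    [Module k M] (r : ℕ) {w : HeightOneSpectrum (𝓞 K)} (hw : w ∉ 𝒰.bad)
    (x y : GL (Fin n) (w.adicCompletion K)) :
    ArithmeticQuotient.heckeFun k (𝒰.hidaLevel r) (ofLocal n K w x) M ∘ₗ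
        ArithmeticQuotient.heckeFun k (𝒰.hidaLevel r) (ofLocal n K w y) M =
      ArithmeticQuotient.heckeFun k (𝒰.hidaLevel r) (ofLocal n K w y) M ∘ₗ
        ArithmeticQuotient.heckeFun k (𝒰.hidaLevel r) (ofLocal n K w x) M :=
  ArithmeticQuotient.heckeFun_comm_of_antiInvolution k M (𝒰.isUnramifiedLevel_hidaLevel r hw)
    (glTranspose (Fin n)) (fun _ hκ => glTranspose_mem_valuedCongruenceSubgroup hκ)
    glTranspose_glTranspose (exists_glTranspose_eq_mul_mul_adicCompletion w (Fin n)) x y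

/-- Every Hida element is a local DIAGONAL element `ι_w(diag(d))` at a Hida place `w`
(`t_{w,j} = ι_w(diag(ϖ,…,ϖ,1,…,1))`, its inverse, `⟨u⟩_v = ι_v(diag(u))`). [folklore] -/
theorem exists_eq_ofLocal_glDiagonal_of_mem_hidaElements {g : FiniteAdelicGL n K}
    (hg : g ∈ 𝒰.hidaElements) :
    ∃ w : HeightOneSpectrum (𝓞 K), 𝒰.IsHidaPlace w ∧
      ∃ d : Fin n → (w.adicCompletion K)ˣ, g = ofLocal n K w (glDiagonal n (w.adicCompletion K) d) := by
  rcases hg with (⟨w, hw, j, rfl⟩ | ⟨w, hw, rfl⟩) | ⟨v, hv, u, rfl⟩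
  · exact ⟨w, hw, _, heckeElement_eq_ofLocal w j⟩
  · exact ⟨w, hw, _, by rw [heckeElement_eq_ofLocal, ← map_inv, ← map_inv]⟩
  · exact ⟨v, Or.inr hv, _, diamondElement_apply v u⟩

/-! ### `GL₂`: at a place above `p` a Hida element is `t_{v,1}` or normalises the tower -/

/-- **Shape of the Hida elements of `GL₂`.**  A Hida element `g` of `GL₂` lives at a Hida place `w`,
is diagonal there, and is EITHER `t_{w,1}` OR normalises every Hida level `U(r)` (it is then
`t_{w,0} = 1`, the central `t_{w,j} = ϖ_w · 1` (`j ≥ 2`) or its inverse, or a diamond element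
`⟨u⟩_w`, `diamondElement_conj_mem_hidaLevel`). [folklore] -/
theorem exists_place_of_mem_hidaElements (𝒰 : TameLevel 2 K p) (h𝒰 : 𝒰.IsMaximalAbove)
    {g : FiniteAdelicGL 2 K} (hg : g ∈ 𝒰.hidaElements) :
    ∃ w : HeightOneSpectrum (𝓞 K), 𝒰.IsHidaPlace w ∧
      (∃ d : Fin 2 → (w.adicCompletion K)ˣ, g = ofLocal 2 K w (glDiagonal 2 (w.adicCompletion K) d)) ∧
      (g = heckeElement 2 K w 1 ∨
        ((∀ r, ∀ x ∈ 𝒰.hidaLevel r, g⁻¹ * x * g ∈ 𝒰.hidaLevel r) ∧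
          ∀ r, ∀ x ∈ 𝒰.hidaLevel r, g * x * g⁻¹ ∈ 𝒰.hidaLevel r)) := by
  rcases hg with (⟨w, hw, j, rfl⟩ | ⟨w, hw, rfl⟩) | ⟨v, hv, u, rfl⟩
  · refine ⟨w, hw, ⟨_, heckeElement_eq_ofLocal w j⟩, ?_⟩
    rcases Nat.lt_or_ge j 2 with hj | hj
    · interval_cases j
      · refine Or.inr ⟨fun r x hx => ?_, fun r x hx => ?_⟩ <;>
          simpa [heckeElement_zero_eq_one] using hx
      · exact Or.inl rfl
    · have hc : heckeElement 2 K w j ∈ Subgroup.center (FiniteAdelicGL 2 K) := by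
        rw [heckeElement_of_le w hj]
        exact heckeElement_self_mem_center w
      refine Or.inr ⟨fun r => conj_mem_of_mem_center' hc _, fun r x hx => ?_⟩
      simpa using conj_mem_of_mem_center' (inv_mem hc) _ x hx
  · refine ⟨w, hw, ⟨_, by rw [heckeElement_eq_ofLocal, ← map_inv, ← map_inv]⟩, Or.inr ?_⟩
    have hc : heckeElement 2 K w 2 ∈ Subgroup.center (FiniteAdelicGL 2 K) :=
      heckeElement_self_mem_center w
    refine ⟨fun r x hx => ?_, fun r x hx => ?_⟩
    · simpa using conj_mem_of_mem_center' (inv_mem hc) _ x hx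
    · simpa using conj_mem_of_mem_center' hc _ x hx
  · refine ⟨v, Or.inr hv, ⟨_, diamondElement_apply v u⟩, Or.inr ⟨fun r x hx =>
      diamondElement_conj_mem_hidaLevel h𝒰 hv u r hx, fun r x hx => ?_⟩⟩
    simpa using diamondElement_conj_mem_hidaLevel h𝒰 hv u⁻¹ r hx

/-- **Any two Hecke operators of the Hida tower of `GL₂` commute on `Fun(GL₂(𝔸^∞)/U(r), M)`**
(`U` maximal above `p`; `g, g'` Hida elements: `T_{w,j}, T_{w,2}⁻¹` for `w ∉ S`, `U_{v,j}, U_{v,2}⁻¹,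
⟨u⟩_v` for `v ∣ p`): different places by factorizability, one good place by Gelfand's trick, one
place above `p` because there one of the two is `t_{v,1}` and the other normalises the level and is
diagonal at `v` (or both are `t_{v,1}`). [cite: KhareThorne2017, §6.2, Lemma 6.5] -/
theorem heckeFun_hidaLevel_comm (𝒰 : TameLevel 2 K p) (h𝒰 : 𝒰.IsMaximalAbove) (k : Type) [CommRing k]
    (M : Type) [AddCommGroup M] [Module k M] (r : ℕ) {g g' : FiniteAdelicGL 2 K}
    (hg : g ∈ 𝒰.hidaElements) (hg' : g' ∈ 𝒰.hidaElements) :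
    ArithmeticQuotient.heckeFun k (𝒰.hidaLevel r) g M ∘ₗ ArithmeticQuotient.heckeFun k (𝒰.hidaLevel r) g' M =
      ArithmeticQuotient.heckeFun k (𝒰.hidaLevel r) g' M ∘ₗ
        ArithmeticQuotient.heckeFun k (𝒰.hidaLevel r) g M := by
  obtain ⟨w, hw, ⟨d, hgd⟩, hgw⟩ := exists_place_of_mem_hidaElements 𝒰 h𝒰 hg
  obtain ⟨w', hw', ⟨d', hg'd'⟩, hg'w'⟩ := exists_place_of_mem_hidaElements 𝒰 h𝒰 hg'
  by_cases hww' : w = w'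
  · subst hww'
    by_cases hp : (p : 𝓞 K) ∈ w.asIdeal
    · -- one place above `p`: the two elements commute, and one of them normalises (or both are `t`)
      have hcomm : g * g' = g' * g := by
        rw [hgd, hg'd', ← map_mul, ← map_mul, ← map_mul, ← map_mul, mul_comm d d']
      rcases hgw with hgt | ⟨hN, hN'⟩
      · rcases hg'w' with hg't | ⟨hM, hM'⟩
        · rw [hgt, hg't]
        · exact ArithmeticQuotient.heckeFun_comm_of_normalizer k M (hM r) (hM' r) hcomm
      · exact (ArithmeticQuotient.heckeFun_comm_of_normalizer k M (hN r) (hN' r) hcomm.symm).symm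
    · -- one good place
      rw [hgd, hg'd']
      exact 𝒰.heckeFun_hidaLevel_comm_of_not_mem k M r (Or.resolve_right hw hp) _ _
  · -- two different places
    rw [hgd, hg'd']
    exact 𝒰.heckeFun_hidaLevel_comm_of_ne h𝒰 k M r hw hw' hww' _ _

/-- **Any two Hecke operators of the Hida tower of `GL₂` commute on every `H^i(X_{U(r)}, k/p^s)`**:
the Hida families `hidaFamily g`, `hidaFamily g'` of Hida elements commute (index-wise).
[cite: KhareThorne2017, §6.2, Lemma 6.5] -/
theorem hidaFamily_comm (𝒰 : TameLevel 2 K p) (h𝒰 : 𝒰.IsMaximalAbove) (k : Type) [CommRing k]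
    {g g' : FiniteAdelicGL 2 K} (hg : g ∈ 𝒰.hidaElements) (hg' : g' ∈ 𝒰.hidaElements)
    (x : TowerIndex) :
    𝒰.hidaFamily k g x * 𝒰.hidaFamily k g' x = 𝒰.hidaFamily k g' x * 𝒰.hidaFamily k g x :=
  ArithmeticQuotient.heckeEnd_comm_of_heckeFun_comm k (globalEmbedding 2 K) (modPow k (p : k) x.2.2)
    (heckeFun_hidaLevel_comm 𝒰 h𝒰 k _ x.2.1 hg hg') x.1

/-- The Hida families (elements of `∏_{(i,r,s)} End H^i(X_{U(r)}, k/p^s)`) of Hida elements of `GL₂`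
commute. [folklore] -/
theorem hidaFamily_mul_comm (𝒰 : TameLevel 2 K p) (h𝒰 : 𝒰.IsMaximalAbove) (k : Type) [CommRing k]
    {g g' : FiniteAdelicGL 2 K} (hg : g ∈ 𝒰.hidaElements) (hg' : g' ∈ 𝒰.hidaElements) :
    𝒰.hidaFamily k g * 𝒰.hidaFamily k g' = 𝒰.hidaFamily k g' * 𝒰.hidaFamily k g :=
  funext fun x => hidaFamily_comm 𝒰 h𝒰 k hg hg' x

/-! ### Consequences: commutative Hecke algebras, and the ordinary part -/

/-- In a ring, the subring generated by a pairwise commuting set is commutative. [folklore] -/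
theorem mul_comm_of_mem_closure {R : Type*} [Ring R] {s : Set R}
    (hs : ∀ a ∈ s, ∀ b ∈ s, a * b = b * a) {a b : R} (ha : a ∈ Subring.closure s)
    (hb : b ∈ Subring.closure s) : a * b = b * a := by
  have ha' := Subring.closure_le_centralizer_centralizer s ha
  have hb' : b ∈ Subring.centralizer s :=
    (Subring.closure_le.2 (fun c hc => Subring.mem_centralizer_iff.2 fun d hd => hs d hd c hc)) hb
  exact (Subring.mem_centralizer_iff.1 ha' b hb').symm

/-- **The finite-level Hida Hecke algebras of `GL₂` are commutative**: any two elements of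
`hidaLevelSubring k x` (the subring of `End H^i(X_{U(r)}, k/p^s)` generated by the Hecke operators of
the Hida elements) commute. [cite: KhareThorne2017, §6.2, Lemma 6.5] -/
theorem hidaLevelSubring_mul_comm (𝒰 : TameLevel 2 K p) (h𝒰 : 𝒰.IsMaximalAbove) (k : Type)
    [CommRing k] (x : TowerIndex) {S T : 𝒰.HidaEndFactor k x} (hS : S ∈ 𝒰.hidaLevelSubring k x)
    (hT : T ∈ 𝒰.hidaLevelSubring k x) : S * T = T * S := by
  refine mul_comm_of_mem_closure ?_ hS hT
  rintro _ ⟨_, ⟨g, hg, rfl⟩, rfl⟩ _ ⟨_, ⟨g', hg', rfl⟩, rfl⟩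
  exact hidaFamily_comm 𝒰 h𝒰 k hg hg' x

/-- Every element of the finite-level algebra commutes with every `U_{v,j}` (indeed with the operator
of every Hida element) — the hypothesis `hcomm` of `ordSpan_eq_range` / `iInf_ordSpan_eq_range`.
[folklore] -/
theorem commute_hidaFamily_of_mem_hidaLevelSubring (𝒰 : TameLevel 2 K p) (h𝒰 : 𝒰.IsMaximalAbove)
    (k : Type) [CommRing k] {x : TowerIndex} {T : 𝒰.HidaEndFactor k x}
    (hT : T ∈ 𝒰.hidaLevelSubring k x) {g : FiniteAdelicGL 2 K} (hg : g ∈ 𝒰.hidaElements) :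
    Commute T (𝒰.hidaFamily k g x) :=
  hidaLevelSubring_mul_comm 𝒰 h𝒰 k x hT (𝒰.hidaFamily_apply_mem_hidaLevelSubring k hg x)

/-- **The ordinary part of `H^i(X_{U(r)}, k/p^s)` for `GL₂` is `⋂_{v ∣ p} ⋂ₘ U_{v,1}^m H`** (`U`
maximal above `p`): the Hecke-stable hulls `𝕋 · U_{v,1}^m H` in the tree's definition of
`ordinaryPart` are just `U_{v,1}^m H`, the finite-level algebra being commutative
(`ordSpan_eq_range`).  With `H` finite this is Hida's `e H`, `e = lim U_p^{m!}`
(`iInf_ordSpan_eq_range`). [cite: KhareThorne2017, §2.4, Lemma 2.10] -/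
theorem ordinaryPart_eq_iInf_range (𝒰 : TameLevel 2 K p) (h𝒰 : 𝒰.IsMaximalAbove) (k : Type)
    [CommRing k] (x : TowerIndex) :
    𝒰.ordinaryPart k x =
      ⨅ (v : {v : HeightOneSpectrum (𝓞 K) // (p : 𝓞 K) ∈ v.asIdeal}) (j : Fin (2 - 1)) (m : ℕ),
        LinearMap.range (HidaEndFactor.toEnd 𝒰 k
          (𝒰.hidaFamily k (heckeElement 2 K v.1 (j.val + 1)) x ^ m)) := by
  unfold ordinaryPart
  refine iInf_congr fun v => iInf_congr fun j => iInf_congr fun m => ?_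
  exact 𝒰.ordSpan_eq_range k (fun T hT => commute_hidaFamily_of_mem_hidaLevelSubring 𝒰 h𝒰 k hT
    (𝒰.heckeElement_mem_hidaElements (Or.inr v.2) _)) m

/-- The generating families of `𝕋^S(𝒰; p)` commute (`GL₂`). [folklore] -/
theorem hidaGenerators_comm (𝒰 : TameLevel 2 K p) (h𝒰 : 𝒰.IsMaximalAbove) (k : Type) [CommRing k] :
    ∀ a ∈ 𝒰.hidaGenerators k, ∀ b ∈ 𝒰.hidaGenerators k, a * b = b * a := by
  rintro _ ⟨g, hg, rfl⟩ _ ⟨g', hg', rfl⟩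
  exact hidaFamily_mul_comm 𝒰 h𝒰 k hg hg'

/-- The generating families of `𝕋^{S,ord}(𝒰)` commute (`GL₂`). [folklore] -/
theorem ordGenerators_comm (𝒰 : TameLevel 2 K p) (h𝒰 : 𝒰.IsMaximalAbove) (k : Type) [CommRing k] :
    ∀ a ∈ 𝒰.ordGenerators k, ∀ b ∈ 𝒰.ordGenerators k, a * b = b * a := by
  rintro _ ⟨g, hg, rfl⟩ _ ⟨g', hg', rfl⟩
  rw [ordFamily, ordFamily, ← map_mul, ← map_mul]
  congr 1
  exact Subtype.ext (hidaFamily_mul_comm 𝒰 h𝒰 k hg hg')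

/-- In a Hausdorff topological ring, the closure of the subring generated by a pairwise commuting set
is commutative. [folklore] -/
theorem mul_comm_of_mem_topologicalClosure_closure {R : Type*} [Ring R] [TopologicalSpace R]
    [IsTopologicalRing R] [T2Space R] {s : Set R} (hs : ∀ a ∈ s, ∀ b ∈ s, a * b = b * a)
    (a b : (Subring.closure s).topologicalClosure) : a * b = b * a := by
  have hcl : ∀ x y : Subring.closure s, x * y = y * x := fun x y =>
    Subtype.ext (mul_comm_of_mem_closure hs x.2 y.2)
  letI : CommRing (Subring.closure s).topologicalClosure :=
    (Subring.closure s).commRingTopologicalClosure hcl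
  exact mul_comm a b

/-- **`𝕋^S(𝒰; p)` is commutative for `GL₂`** (`U` maximal above `p`). [cite: KhareThorne2017, §6.2, Lemma 6.5] -/
theorem hidaHeckeSubring_mul_comm (𝒰 : TameLevel 2 K p) (h𝒰 : 𝒰.IsMaximalAbove) (k : Type)
    [CommRing k] (a b : 𝒰.hidaHeckeSubring k) : a * b = b * a :=
  mul_comm_of_mem_topologicalClosure_closure (hidaGenerators_comm 𝒰 h𝒰 k) a b

/-- **The ordinary big Hecke algebra `𝕋^{S,ord}(𝒰)_k` is commutative for `GL₂`** (`U` maximal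
above `p`). [cite: KhareThorne2017, §6.5 (𝕋^S_ord(U))] -/
theorem ordHeckeSubring_mul_comm (𝒰 : TameLevel 2 K p) (h𝒰 : 𝒰.IsMaximalAbove) (k : Type)
    [CommRing k] (a b : 𝒰.ordHeckeSubring k) : a * b = b * a :=
  mul_comm_of_mem_topologicalClosure_closure (ordGenerators_comm 𝒰 h𝒰 k) a b

end TameLevel

end BigHeckeGLn

open BigHeckeGLn in
/-- **`OrdinaryHeckeAlgebraGLn 𝒰 = 𝕋^{S,ord}(𝒰)` is commutative** for a tame level `𝒰` of `GL₂`
maximal above `p` (Hida's ordinary Hecke algebra is commutative). [cite: Hida1994AIF, §2] -/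
theorem OrdinaryHeckeAlgebraGLn.mul_comm_of_isMaximalAbove {K : Type} [Field K] [NumberField K]
    {p : ℕ} [Fact p.Prime] {𝒰 : TameLevel 2 K p} (h𝒰 : 𝒰.IsMaximalAbove)
    (a b : OrdinaryHeckeAlgebraGLn 𝒰) : a * b = b * a :=
  TameLevel.ordHeckeSubring_mul_comm 𝒰 h𝒰 ℤ a b

open BigHeckeGLn in
/-- **`HidaHeckeAlgebraGLn 𝒰 = 𝕋^S(𝒰; p)` is commutative** for a tame level `𝒰` of `GL₂` maximal
above `p`. [cite: Hida1994AIF, §2] -/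
theorem HidaHeckeAlgebraGLn.mul_comm_of_isMaximalAbove {K : Type} [Field K] [NumberField K]
    {p : ℕ} [Fact p.Prime] {𝒰 : TameLevel 2 K p} (h𝒰 : 𝒰.IsMaximalAbove)
    (a b : HidaHeckeAlgebraGLn 𝒰) : a * b = b * a :=
  TameLevel.hidaHeckeSubring_mul_comm 𝒰 h𝒰 ℤ a b

end Literature.NumberTheory.Automorphic
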